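import Summits.NavierStokesRegularity.NavierStokesRegularity.Theorems.CoriolisHeadFarFieldShellMean
import Summits.NavierStokesRegularity.NavierStokesRegularity.Theorems.CoriolisHeadCounterRotatingLiouvilleCalculus
import Literature.Analysis.FluidPDE.BiotSavartCurlPair
import Literature.Analysis.FluidPDE.SteadyLiouvilleTsaiPressure
import Literature.Analysis.FluidPDE.ConstantinFeffermanStretching
import Literature.Analysis.FluidPDE.EnstrophySplitting
import Mathlib.MeasureTheory.Function.L2Space
import Mathlib.Analysis.SpecificLimits.Basic
import HarnessLib

/-!
# CoriolisHeadFarFieldLimitTools — crux `NoCoRotatingCore` (stmt-NavierStokesRegularity-22676), line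
# `far_field_constancy` v2 (skeleton 15c9a82ad206abb9), stub K1b `stub_farFieldLimit` — file 1/2: tools

Setting (the rotated Leray profile system of the route `CoriolisHead`; Pineau–Vicol (1.8) with a general skew
`B`): `U ∈ C^∞(ℝ³; ℝ³)`, `P ∈ C²`, `div U = 0`, `−νΔU + aU + a(y·∇)U + (BU − (By·∇)U) + (U·∇)U + ∇P = 0`,
`‖U‖ ≤ M`, together with the K1a hypothesis of the line (scale-natural derivative decay)
`‖y‖‖DU(y)‖ + ‖y‖²‖D²U(y)‖ → 0`.  The companion file `CoriolisHeadFarFieldLimit.lean` (2/2) proves `∇P → g`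
at infinity and K1b BY NAME (`U → b`); this file supplies the pointwise inputs:

* §1 tools: `‖v‖ ≤ c` from `|⟪v, e⟫| ≤ c‖e‖` for all `e`; the components
  `⟪∫ λ^{R,2R} • ∇P, e⟫ = ∫ λ^{R,2R} ∂ₑP` of the vector shell mean against the tree's mass-one weight
  `λ^{R,2R} = newtonFarLaplacian R (2R)`; a dyadic Cauchy criterion (`‖F_k − F_{k+1}‖ ≤ A/2^k ⇒ F_k → g`).
* §2 consequences of K1a beyond a radius `R_δ ≥ 1`: `‖DU‖ ≤ δ/‖y‖`, `‖D²U‖ ≤ δ/‖y‖²`; the REMAINDER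
  `R₀ := ∇P + aU + BU = νΔU − aDU·y + DU·By − DU·U` (tree `gradient_pressure_eq_of_rotated`) obeys
  `‖R₀(y)‖ ≤ (3ν + a + ‖B‖ + M)δ`; the pressure Poisson equation `ΔP = −tr(DU∘DU)` (tree
  `laplacian_pressure_eq_of_rotated`) gives `|ΔP(z)| ≤ 3δ²/‖z‖²`.
* §3 oscillation: `∂ₑP = ⟪R₀, e⟫ − ⟪U, ae − Be⟫` (skewness of `B`); the oscillation of `⟪U, v⟫` over a shell
  `R ≤ ‖z‖ ≤ 2R` is `≤ 18δ‖v‖` (tree `Tsai2021.abs_sub_le_of_shell`: radius, then great circle), hence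
  `|∂ₑP(w) − ∂ₑP(z)| ≤ (2(3ν + a + ‖B‖ + M) + 18(a + ‖B‖)) δ ‖e‖` on far shells.

Everything is proved; no definitions, no named facts.  WHAT THIS IS NOT: nothing here proves K1a
(`stub_scaleNaturalDecay`), K1c (`stub_typeIRate`), `NoCoRotatingCore`, Pineau–Vicol's Conjecture 1.1 or
Navier–Stokes regularity; this is a support step of a crux LINE about hypothetical blow-up profiles.

References: B. Pineau, V. Vicol, arXiv:2607.09619 (2026), (1.8), proof of Lemma 2.1 [PineauVicol2026];
T.-P. Tsai, Arch. Rational Mech. Anal. 143 (1998), §3 [Tsai1998]; D. Gilbarg, N. S. Trudinger, *Elliptic PDE of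
second order* (2001), §2.4–§2.7 [GilbargTrudinger2001].
-/

noncomputable section

open MeasureTheory Set Function Filter Topology Metric InnerProductSpace Real
open scoped RealInnerProductSpace Laplacian ContDiff

-- the summit and its single sub-problem share the name (CONVENTIONS §1), as in every Theorems file
set_option linter.dupNamespace false

namespace Summit.NavierStokesRegularity.NavierStokesRegularity.Theorems.CoriolisHead

namespace FarFieldLimit

open Literature.Analysis.FluidPDE

/-! ## §1 Tools: sup over directions, vector shell means, dyadic Cauchy criterion -/

/-- If `|⟪v, e⟫| ≤ c‖e‖` for every direction `e` (and `c ≥ 0`) then `‖v‖ ≤ c` (take `e = v`). [folklore] -/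
theorem norm_le_of_forall_abs_inner_le {v : EuclideanSpace ℝ (Fin 3)} {c : ℝ} (hc : 0 ≤ c)
    (h : ∀ e : EuclideanSpace ℝ (Fin 3), |⟪v, e⟫| ≤ c * ‖e‖) : ‖v‖ ≤ c := by
  have h1 : ‖v‖ * ‖v‖ ≤ c * ‖v‖ := by
    have h2 := h v
    rwa [real_inner_self_eq_norm_mul_norm, abs_of_nonneg (mul_nonneg (norm_nonneg _) (norm_nonneg _))]
      at h2
  by_cases hv : ‖v‖ = 0
  · rw [hv]; exact hc
  · exact le_of_mul_le_mul_right h1 (lt_of_le_of_ne (norm_nonneg _) (Ne.symm hv))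

/-- `a • id + B` is onto for `a ≠ 0` and `B` skew: `⟪(a + B)y, y⟫ = a‖y‖²` gives injectivity, and an
injective endomorphism of `ℝ³` is surjective (compare `exists_recentre` of `CoriolisHeadFarFieldCovariance`,
stated there for `a − B`). [folklore] -/
theorem exists_add_clm_apply_eq_of_skew {B : EuclideanSpace ℝ (Fin 3) →L[ℝ] EuclideanSpace ℝ (Fin 3)}
    (hB : ∀ x, inner ℝ (B x) x = 0) {a : ℝ} (ha : a ≠ 0) (v : EuclideanSpace ℝ (Fin 3)) :
    ∃ y : EuclideanSpace ℝ (Fin 3), a • y + B y = v := by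
  set L : EuclideanSpace ℝ (Fin 3) →ₗ[ℝ] EuclideanSpace ℝ (Fin 3) :=
    a • LinearMap.id + B.toLinearMap with hL
  have hLapply : ∀ y, L y = a • y + B y := fun y => by simp [hL]
  have hinj : Function.Injective L := by
    intro y z hyz
    have h0 : L (y - z) = 0 := by rw [map_sub, hyz, sub_self]
    have key : ⟪L (y - z), y - z⟫ = a * ‖y - z‖ ^ 2 := by
      rw [hLapply, inner_add_left, real_inner_smul_left, hB (y - z), real_inner_self_eq_norm_sq]
      ring
    rw [h0, inner_zero_left] at key
    have hn : ‖y - z‖ ^ 2 = 0 := by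
      rcases mul_eq_zero.1 key.symm with h | h
      · exact absurd h ha
      · exact h
    exact sub_eq_zero.1 (norm_eq_zero.1 (pow_eq_zero_iff two_ne_zero |>.1 hn))
  obtain ⟨y₀, hy₀⟩ := (LinearMap.injective_iff_surjective.1 hinj) v
  exact ⟨y₀, by rw [← hLapply, hy₀]⟩

/-- The gradient of a `C¹` function is continuous. [folklore] -/
theorem continuous_gradient_of_contDiff {P : EuclideanSpace ℝ (Fin 3) → ℝ} (hP : ContDiff ℝ 1 P) :
    Continuous (gradient P) := by
  have : gradient P = fun z => (InnerProductSpace.toDual ℝ (EuclideanSpace ℝ (Fin 3))).symm (fderiv ℝ P z) :=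
    rfl
  rw [this]
  exact (InnerProductSpace.toDual ℝ (EuclideanSpace ℝ (Fin 3))).symm.continuous.comp
    (hP.continuous_fderiv one_ne_zero)

/-- **Components of the vector shell mean**: `⟪∫ λ^{R,2R} • ∇P, e⟫ = ∫ λ^{R,2R} ∂ₑP` for `P ∈ C¹`
(the weight is continuous with compact support, so the Bochner integral commutes with `⟪·, e⟫`). [folklore] -/
theorem inner_shellMean_gradient {R : ℝ} (hR : 0 < R) {P : EuclideanSpace ℝ (Fin 3) → ℝ}
    (hP : ContDiff ℝ 1 P) (e : EuclideanSpace ℝ (Fin 3)) :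
    ⟪∫ z, newtonFarLaplacian R (2 * R) z • gradient P z, e⟫ =
      ∫ z, newtonFarLaplacian R (2 * R) z * fderiv ℝ P z e := by
  have h2R : R < 2 * R := by linarith
  have hlc : Continuous (newtonFarLaplacian R (2 * R)) := continuous_newtonFarLaplacian hR h2R
  have hls : HasCompactSupport (newtonFarLaplacian R (2 * R)) :=
    hasCompactSupport_newtonFarLaplacian hR.le h2R
  have hgc : Continuous (gradient P) := continuous_gradient_of_contDiff hP
  have hint : Integrable (fun z => newtonFarLaplacian R (2 * R) z • gradient P z) :=
    (hlc.smul hgc).integrable_of_hasCompactSupport hls.smul_right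
  rw [real_inner_comm, ← integral_inner hint e]
  refine integral_congr_ae (Eventually.of_forall fun z => ?_)
  show ⟪e, newtonFarLaplacian R (2 * R) z • gradient P z⟫ = newtonFarLaplacian R (2 * R) z * fderiv ℝ P z e
  rw [inner_smul_right, real_inner_comm, inner_gradient_left]

/-- **Dyadic Cauchy criterion** in `ℝ³`: if `‖F k − F (k+1)‖ ≤ A/2^k` then `F → g` for some `g` with
`‖F k − g‖ ≤ 2A/2^k`. [folklore] -/
theorem exists_tendsto_of_norm_sub_succ_le {F : ℕ → EuclideanSpace ℝ (Fin 3)} {A : ℝ}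
    (h : ∀ k, ‖F k - F (k + 1)‖ ≤ A / 2 ^ k) :
    ∃ g : EuclideanSpace ℝ (Fin 3), Tendsto F atTop (𝓝 g) ∧ ∀ k, ‖F k - g‖ ≤ 2 * A / 2 ^ k := by
  have h' : ∀ k, dist (F k) (F (k + 1)) ≤ (2 * A) / 2 / 2 ^ k := fun k => by
    rw [dist_eq_norm]
    convert h k using 1
    ring
  obtain ⟨g, hg⟩ := cauchySeq_tendsto_of_complete (cauchySeq_of_le_geometric_two h')
  exact ⟨g, hg, fun k => by
    rw [← dist_eq_norm]
    exact dist_le_of_le_geometric_two_of_tendsto h' hg k⟩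

/-! ## §2 Consequences of scale-natural decay for a rotated profile -/

section Profile

variable {ν a : ℝ} {B : EuclideanSpace ℝ (Fin 3) →L[ℝ] EuclideanSpace ℝ (Fin 3)}
  {U : EuclideanSpace ℝ (Fin 3) → EuclideanSpace ℝ (Fin 3)} {P : EuclideanSpace ℝ (Fin 3) → ℝ}

/-- Unpacking K1a at level `δ`: beyond some `R_δ ≥ 1`, `‖DU(y)‖ ≤ δ/‖y‖` and `‖D²U(y)‖ ≤ δ/‖y‖²`. -/
theorem exists_radius_decay
    (hdecay : ∀ ε : ℝ, 0 < ε → ∃ R : ℝ, ∀ y : EuclideanSpace ℝ (Fin 3), R ≤ ‖y‖ →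
      ‖y‖ * ‖fderiv ℝ U y‖ + ‖y‖ ^ 2 * ‖iteratedFDeriv ℝ 2 U y‖ ≤ ε)
    {δ : ℝ} (hδ : 0 < δ) :
    ∃ R : ℝ, 1 ≤ R ∧ ∀ y : EuclideanSpace ℝ (Fin 3), R ≤ ‖y‖ →
      ‖fderiv ℝ U y‖ ≤ δ / ‖y‖ ∧ ‖iteratedFDeriv ℝ 2 U y‖ ≤ δ / ‖y‖ ^ 2 := by
  obtain ⟨R, hR⟩ := hdecay δ hδ
  refine ⟨max R 1, le_max_right _ _, fun y hy => ?_⟩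
  have hy1 : 1 ≤ ‖y‖ := (le_max_right _ _).trans hy
  have hypos : 0 < ‖y‖ := one_pos.trans_le hy1
  have h := hR y ((le_max_left _ _).trans hy)
  have h1 : 0 ≤ ‖y‖ * ‖fderiv ℝ U y‖ := by positivity
  have h2 : 0 ≤ ‖y‖ ^ 2 * ‖iteratedFDeriv ℝ 2 U y‖ := by positivity
  constructor
  · rw [le_div_iff₀ hypos]
    linarith
  · rw [le_div_iff₀ (pow_pos hypos 2)]
    linarith

/-- **The remainder is small at infinity.**  With `R₀ := ∇P + aU + BU` one has, by the system,
`R₀ = νΔU − aDU·y + DU·By − DU·U`; if `‖DU‖ ≤ δ/‖y‖`, `‖D²U‖ ≤ δ/‖y‖²` beyond `R ≥ 1` and `‖U‖ ≤ M`, then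
`‖R₀(y)‖ ≤ (3ν + a + ‖B‖ + M) δ` beyond `R`. [cite: PineauVicol2026, (1.8a) (p. 3)] -/
theorem norm_gradient_add_linear_le (hν : 0 ≤ ν) (ha : 0 ≤ a) (hU2 : ContDiff ℝ 2 U)
    (heq : ∀ y, -(ν • (Δ U) y) + a • U y + a • fderiv ℝ U y y + (B (U y) - fderiv ℝ U y (B y)) +
      convect U U y + gradient P y = 0)
    {M : ℝ} (hM : ∀ y, ‖U y‖ ≤ M) {δ R : ℝ} (hδ : 0 ≤ δ) (hR1 : 1 ≤ R)
    (hR : ∀ y : EuclideanSpace ℝ (Fin 3), R ≤ ‖y‖ →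
      ‖fderiv ℝ U y‖ ≤ δ / ‖y‖ ∧ ‖iteratedFDeriv ℝ 2 U y‖ ≤ δ / ‖y‖ ^ 2)
    (y : EuclideanSpace ℝ (Fin 3)) (hy : R ≤ ‖y‖) :
    ‖gradient P y + (a • U y + B (U y))‖ ≤ (3 * ν + a + ‖B‖ + M) * δ := by
  have hM0 : 0 ≤ M := (norm_nonneg _).trans (hM 0)
  have hy1 : 1 ≤ ‖y‖ := hR1.trans hy
  have hypos : 0 < ‖y‖ := one_pos.trans_le hy1
  obtain ⟨hD1, hD2⟩ := hR y hy
  have hrepr : gradient P y + (a • U y + B (U y)) =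
      ν • (Δ U) y - a • fderiv ℝ U y y + fderiv ℝ U y (B y) - fderiv ℝ U y (U y) := by
    rw [gradient_pressure_eq_of_rotated heq y, convect_apply]
    abel
  -- the four terms
  have hΔ : ‖(Δ U) y‖ ≤ 3 * δ := by
    have h1 := norm_laplacian_le_three_mul_norm_iteratedFDeriv_two hU2 y
    have h2 : ‖iteratedFDeriv ℝ 2 U y‖ ≤ δ := by
      refine hD2.trans ?_
      rw [div_le_iff₀ (pow_pos hypos 2)]
      nlinarith [one_le_pow₀ (n := 2) hy1]
    linarith
  have hDU : ‖fderiv ℝ U y‖ * ‖y‖ ≤ δ := by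
    rwa [le_div_iff₀ hypos] at hD1
  have hDUδ : ‖fderiv ℝ U y‖ ≤ δ := by
    refine hD1.trans ?_
    rw [div_le_iff₀ hypos]
    nlinarith
  have t1 : ‖ν • (Δ U) y‖ ≤ ν * (3 * δ) := by
    rw [norm_smul, Real.norm_of_nonneg hν]
    exact mul_le_mul_of_nonneg_left hΔ hν
  have t2 : ‖a • fderiv ℝ U y y‖ ≤ a * δ := by
    rw [norm_smul, Real.norm_of_nonneg ha]
    exact mul_le_mul_of_nonneg_left ((ContinuousLinearMap.le_opNorm _ _).trans hDU) ha
  have t3 : ‖fderiv ℝ U y (B y)‖ ≤ ‖B‖ * δ := by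
    calc ‖fderiv ℝ U y (B y)‖ ≤ ‖fderiv ℝ U y‖ * ‖B y‖ := ContinuousLinearMap.le_opNorm _ _
      _ ≤ ‖fderiv ℝ U y‖ * (‖B‖ * ‖y‖) :=
          mul_le_mul_of_nonneg_left (ContinuousLinearMap.le_opNorm _ _) (norm_nonneg _)
      _ = ‖B‖ * (‖fderiv ℝ U y‖ * ‖y‖) := by ring
      _ ≤ ‖B‖ * δ := mul_le_mul_of_nonneg_left hDU (norm_nonneg _)
  have t4 : ‖fderiv ℝ U y (U y)‖ ≤ M * δ := by
    calc ‖fderiv ℝ U y (U y)‖ ≤ ‖fderiv ℝ U y‖ * ‖U y‖ := ContinuousLinearMap.le_opNorm _ _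
      _ ≤ δ * M := mul_le_mul hDUδ (hM y) (norm_nonneg _) hδ
      _ = M * δ := mul_comm _ _
  rw [hrepr]
  have s1 := norm_sub_le (ν • (Δ U) y - a • fderiv ℝ U y y + fderiv ℝ U y (B y)) (fderiv ℝ U y (U y))
  have s2 := norm_add_le (ν • (Δ U) y - a • fderiv ℝ U y y) (fderiv ℝ U y (B y))
  have s3 := norm_sub_le (ν • (Δ U) y) (a • fderiv ℝ U y y)
  have e : (3 * ν + a + ‖B‖ + M) * δ = ν * (3 * δ) + a * δ + ‖B‖ * δ + M * δ := by ring
  rw [e]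
  linarith

/-- **The pressure Laplacian decays like `‖z‖⁻²`**: `ΔP = −tr(DU∘DU)` and `|tr L| ≤ 3‖L‖` on `ℝ³`, so
`‖DU(z)‖ ≤ δ/‖z‖` gives `|ΔP(z)| ≤ 3δ²/‖z‖²`. [cite: PineauVicol2026, proof of Lemma 2.1 (p. 9)] -/
theorem abs_laplacian_pressure_le (hU3 : ContDiff ℝ 3 U) (hP2 : ContDiff ℝ 2 P)
    (hdiv : VectorCalculus.IsDivFree U)
    (heq : ∀ y, -(ν • (Δ U) y) + a • U y + a • fderiv ℝ U y y + (B (U y) - fderiv ℝ U y (B y)) +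
      convect U U y + gradient P y = 0)
    {δ R : ℝ}
    (hR : ∀ y : EuclideanSpace ℝ (Fin 3), R ≤ ‖y‖ →
      ‖fderiv ℝ U y‖ ≤ δ / ‖y‖ ∧ ‖iteratedFDeriv ℝ 2 U y‖ ≤ δ / ‖y‖ ^ 2)
    (z : EuclideanSpace ℝ (Fin 3)) (hz : R ≤ ‖z‖) : |(Δ P) z| ≤ 3 * δ ^ 2 / ‖z‖ ^ 2 := by
  obtain ⟨hD1, -⟩ := hR z hz
  rw [laplacian_pressure_eq_of_rotated hU3 hP2 hdiv heq z, abs_neg]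
  have hcomp : ‖(fderiv ℝ U z).comp (fderiv ℝ U z)‖ ≤ (δ / ‖z‖) ^ 2 := by
    calc ‖(fderiv ℝ U z).comp (fderiv ℝ U z)‖ ≤ ‖fderiv ℝ U z‖ * ‖fderiv ℝ U z‖ :=
          ContinuousLinearMap.opNorm_comp_le _ _
      _ ≤ (δ / ‖z‖) * (δ / ‖z‖) :=
          mul_le_mul hD1 hD1 (norm_nonneg _) ((norm_nonneg _).trans hD1)
      _ = (δ / ‖z‖) ^ 2 := by ring
  calc |traceCLM ((fderiv ℝ U z).comp (fderiv ℝ U z))|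
      ≤ 3 * ‖(fderiv ℝ U z).comp (fderiv ℝ U z)‖ := abs_traceCLM_le_three_mul_opNorm _
    _ ≤ 3 * (δ / ‖z‖) ^ 2 := by linarith
    _ = 3 * δ ^ 2 / ‖z‖ ^ 2 := by rw [div_pow]; ring


/-! ## §3 Oscillation of `∂ₑP` over far shells -/

/-- The component identity `∂ₑP = ⟪R₀, e⟫ − ⟪U, ae − Be⟫` (`R₀ = ∇P + aU + BU`, `B` skew). [folklore] -/
theorem fderiv_pressure_apply_eq (hB : ∀ x, inner ℝ (B x) x = 0) (y e : EuclideanSpace ℝ (Fin 3)) :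
    fderiv ℝ P y e = ⟪gradient P y + (a • U y + B (U y)), e⟫ - ⟪U y, a • e - B e⟫ := by
  rw [← inner_gradient_left P y e, inner_add_left, inner_add_left, real_inner_smul_left, inner_sub_right,
    real_inner_smul_right, inner_clm_left_eq_neg_of_skew hB (U y) e]
  ring

/-- **Oscillation of a component of `U` over a shell**: if `‖DU(x)‖ ≤ δ/‖x‖` for `‖x‖ ≥ R > 0` then
`|⟪U w, v⟫ − ⟪U z, v⟫| ≤ 18 δ ‖v‖` for `w, z` in the shell `R ≤ ‖·‖ ≤ 2R` (radius, then great circle: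
tree `Tsai2021.abs_sub_le_of_shell`). [cite: Tsai1998, §3] -/
theorem abs_inner_sub_inner_le_of_shell (hU1 : ContDiff ℝ 1 U) {δ R : ℝ} (hδ : 0 ≤ δ) (hRpos : 0 < R)
    (hR : ∀ y : EuclideanSpace ℝ (Fin 3), R ≤ ‖y‖ → ‖fderiv ℝ U y‖ ≤ δ / ‖y‖)
    (v : EuclideanSpace ℝ (Fin 3)) {w z : EuclideanSpace ℝ (Fin 3)}
    (hw1 : R ≤ ‖w‖) (hw2 : ‖w‖ ≤ 2 * R) (hz1 : R ≤ ‖z‖) (hz2 : ‖z‖ ≤ 2 * R) :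
    |⟪U w, v⟫ - ⟪U z, v⟫| ≤ 18 * δ * ‖v‖ := by
  have hUd : Differentiable ℝ U := hU1.differentiable one_ne_zero
  set ψ : EuclideanSpace ℝ (Fin 3) → ℝ := fun y => (innerSL ℝ v) (U y) with hψ
  have hψd : Differentiable ℝ ψ := (innerSL ℝ v).differentiable.comp hUd
  have hψD : ∀ x : EuclideanSpace ℝ (Fin 3), R ≤ ‖x‖ → ‖x‖ ≤ 2 * R →
      ‖fderiv ℝ ψ x‖ ≤ δ * ‖v‖ / R := by
    intro x hx1 _
    have hxpos : 0 < ‖x‖ := hRpos.trans_le hx1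
    have hfd : fderiv ℝ ψ x = (innerSL ℝ v).comp (fderiv ℝ U x) :=
      ((innerSL ℝ v).hasFDerivAt.comp x (hUd x).hasFDerivAt).fderiv
    rw [hfd]
    calc ‖(innerSL ℝ v).comp (fderiv ℝ U x)‖ ≤ ‖innerSL ℝ v‖ * ‖fderiv ℝ U x‖ :=
          ContinuousLinearMap.opNorm_comp_le _ _
      _ ≤ ‖v‖ * (δ / R) := by
          rw [innerSL_apply_norm]
          refine mul_le_mul_of_nonneg_left ((hR x hx1).trans ?_) (norm_nonneg _)
          exact div_le_div_of_nonneg_left hδ hRpos hx1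
      _ = δ * ‖v‖ / R := by ring
  have h := Tsai2021.abs_sub_le_of_shell hψd hRpos hψD hw1 hw2 hz1 hz2
  have e1 : ψ w = ⟪U w, v⟫ := by simp only [hψ, innerSL_apply_apply]; exact real_inner_comm _ _
  have e2 : ψ z = ⟪U z, v⟫ := by simp only [hψ, innerSL_apply_apply]; exact real_inner_comm _ _
  rw [e1, e2] at h
  refine h.trans (le_of_eq ?_)
  field_simp
  ring

/-- **Oscillation of `∂ₑP` over a far shell.**  If beyond `R_δ ≥ 1` one has `‖DU‖ ≤ δ/‖y‖`,
`‖D²U‖ ≤ δ/‖y‖²`, then for every `R ≥ R_δ` and `w, z` in the shell `R ≤ ‖·‖ ≤ 2R`,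
`|∂ₑP(w) − ∂ₑP(z)| ≤ (2(3ν + a + ‖B‖ + M) + 18(a + ‖B‖)) δ ‖e‖`. [folklore] -/
theorem abs_fderiv_pressure_sub_le_of_shell (hν : 0 ≤ ν) (ha : 0 ≤ a)
    (hB : ∀ x, inner ℝ (B x) x = 0) (hU2 : ContDiff ℝ 2 U)
    (heq : ∀ y, -(ν • (Δ U) y) + a • U y + a • fderiv ℝ U y y + (B (U y) - fderiv ℝ U y (B y)) +
      convect U U y + gradient P y = 0)
    {M : ℝ} (hM : ∀ y, ‖U y‖ ≤ M) {δ Rδ : ℝ} (hδ : 0 ≤ δ) (hRδ1 : 1 ≤ Rδ)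
    (hRδ : ∀ y : EuclideanSpace ℝ (Fin 3), Rδ ≤ ‖y‖ →
      ‖fderiv ℝ U y‖ ≤ δ / ‖y‖ ∧ ‖iteratedFDeriv ℝ 2 U y‖ ≤ δ / ‖y‖ ^ 2)
    {R : ℝ} (hR : Rδ ≤ R) (e : EuclideanSpace ℝ (Fin 3)) {w z : EuclideanSpace ℝ (Fin 3)}
    (hw1 : R ≤ ‖w‖) (hw2 : ‖w‖ ≤ 2 * R) (hz1 : R ≤ ‖z‖) (hz2 : ‖z‖ ≤ 2 * R) :
    |fderiv ℝ P w e - fderiv ℝ P z e| ≤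
      (2 * (3 * ν + a + ‖B‖ + M) + 18 * (a + ‖B‖)) * δ * ‖e‖ := by
  have hRpos : 0 < R := one_pos.trans_le (hRδ1.trans hR)
  set v : EuclideanSpace ℝ (Fin 3) := a • e - B e with hv
  have hvn : ‖v‖ ≤ (a + ‖B‖) * ‖e‖ := by
    calc ‖v‖ ≤ ‖a • e‖ + ‖B e‖ := norm_sub_le _ _
      _ ≤ a * ‖e‖ + ‖B‖ * ‖e‖ := by
          rw [norm_smul, Real.norm_of_nonneg ha]
          exact add_le_add le_rfl (B.le_opNorm e)
      _ = (a + ‖B‖) * ‖e‖ := by ring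
  -- the remainder part
  have hRw := norm_gradient_add_linear_le hν ha hU2 heq hM hδ hRδ1 hRδ w (hR.trans hw1)
  have hRz := norm_gradient_add_linear_le hν ha hU2 heq hM hδ hRδ1 hRδ z (hR.trans hz1)
  -- the `U` part
  have hosc := abs_inner_sub_inner_le_of_shell (hU2.of_le one_le_two) hδ hRpos
    (fun y hy => (hRδ y (hR.trans hy)).1) v hw1 hw2 hz1 hz2
  rw [fderiv_pressure_apply_eq hB w e, fderiv_pressure_apply_eq hB z e]
  have h1 : |⟪gradient P w + (a • U w + B (U w)), e⟫ - ⟪gradient P z + (a • U z + B (U z)), e⟫| ≤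
      2 * (3 * ν + a + ‖B‖ + M) * δ * ‖e‖ := by
    refine (abs_sub _ _).trans ?_
    have i1 := abs_real_inner_le_norm (gradient P w + (a • U w + B (U w))) e
    have i2 := abs_real_inner_le_norm (gradient P z + (a • U z + B (U z))) e
    have j1 := mul_le_mul_of_nonneg_right hRw (norm_nonneg e)
    have j2 := mul_le_mul_of_nonneg_right hRz (norm_nonneg e)
    linarith
  have h2 : |⟪U w, v⟫ - ⟪U z, v⟫| ≤ 18 * (a + ‖B‖) * δ * ‖e‖ := by
    refine hosc.trans ?_
    have := mul_le_mul_of_nonneg_left hvn (by positivity : (0 : ℝ) ≤ 18 * δ)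
    linarith
  calc |⟪gradient P w + (a • U w + B (U w)), e⟫ - ⟪U w, v⟫ -
        (⟪gradient P z + (a • U z + B (U z)), e⟫ - ⟪U z, v⟫)|
      = |(⟪gradient P w + (a • U w + B (U w)), e⟫ - ⟪gradient P z + (a • U z + B (U z)), e⟫) -
          (⟪U w, v⟫ - ⟪U z, v⟫)| := by ring_nf
    _ ≤ |⟪gradient P w + (a • U w + B (U w)), e⟫ - ⟪gradient P z + (a • U z + B (U z)), e⟫| +
          |⟪U w, v⟫ - ⟪U z, v⟫| := abs_sub _ _
    _ ≤ 2 * (3 * ν + a + ‖B‖ + M) * δ * ‖e‖ + 18 * (a + ‖B‖) * δ * ‖e‖ := add_le_add h1 h2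
    _ = (2 * (3 * ν + a + ‖B‖ + M) + 18 * (a + ‖B‖)) * δ * ‖e‖ := by ring

end Profile

end FarFieldLimit

end Summit.NavierStokesRegularity.NavierStokesRegularity.Theorems.CoriolisHead

end
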